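import Literature.AlgebraicGeometry.Resolution.Lipman1969RationalSurfaceSingularities
import Literature.AlgebraicGeometry.Resolution.Blowups
import Literature.AlgebraicGeometry.Resolution.BlowupsFlatBaseChange
import Literature.AlgebraicGeometry.Resolution.BlowupClosedPointRegularSurface
import Literature.AlgebraicGeometry.Resolution.BlowupExceptionalFibreNontrivial
import Literature.AlgebraicGeometry.Resolution.ExceptionalCurvePoints
import Literature.AlgebraicGeometry.Resolution.ExceptionalPointsFinite
import Literature.AlgebraicGeometry.Resolution.ComponentsUnderIntegralFlat
import Literature.AlgebraicGeometry.Resolution.RegularLocalRingsNormal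
import Literature.AlgebraicGeometry.Resolution.AlterationsResolution
import HarnessLib

/-!
# Localising a factored resolution at a closed point of the first exceptional curve: the number of
# exceptional curves drops

Topic: `Literature/AlgebraicGeometry/Resolution`. Brick (M) of the sub-cell «(1.2) 2-reg» of the D-0154 (2)
RES inputs cell (planner skeleton `F79_2reg_BRICKS_SKELETON.lean`, `stub_measure_drop`; statement
byte-verbatim): for `T` a regular local ring of dimension two, `π : X → Spec T` a resolution factored as
`π = ρ ≫ bl` through the blow-up `bl : Y₁ → Spec T` of the closed point (`I(⊤) = 𝔪_T`) with `ρ` proper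
birational, and `y ∈ Y₁` a point with `dim 𝒪_{Y₁,y} = 2`, the base change
`ρ_y : X ×_{Y₁} Spec 𝒪_{Y₁,y} → Spec 𝒪_{Y₁,y}` is a resolution and
`#excCurvePoints ρ_y < #excCurvePoints π`.

Proof.  `ρ_y` is a resolution by flat base change (`IsResolution.pullback_snd_fromSpecStalk`: proper;
birational by `IsBirational.of_isPullback_of_flat`, a Literature copy of the Summits-side lemma of the Descent
route; regular source because the projection `X ×_{Y₁} Spec 𝒪_{Y₁,y} → X` is a flat preimmersion,
`mem_regularLocus_iff_pullback_fst_fromSpecStalk`).  The point `y` is CLOSED and lies over `𝔪`: it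
specialises to a closed point `c` over `𝔪` (`bl` proper, `T` local), and `c ≠ y` would force
`dim 𝒪_{Y₁,c} ≥ 3` (Mathlib `ringKrullDim_stalk_eq_coheight`), against `dim ≤ 2` on the regular surface `Y₁`
(`isRegular_of_isBlowup_closedPoint_of_isRegularLocalRing`).  The projection `f : X ×_{Y₁} Spec 𝒪_{Y₁,y} → X`
is injective and monotone for specialisation, so it maps `excCurvePoints ρ_y` (height-one points of the
closed fibre of `ρ_y`) injectively into `{η ∈ excCurvePoints π | ρ η = y}` (`π (f s) = bl y = 𝔪`; height
exactly one by `IsResolution.height_le_one_of_base_eq_closedPoint`).  Strictness: the exceptional fibre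
`E₁ = bl⁻¹(𝔪)` has a NON-CLOSED point `e` (`IsBlowup.exists_specializes_ne_of_mem_preimage`), so `e ≠ y`;
`ρ` is surjective (proper and dominant), and a point `x_e` over `e` lies in `excCurvePoints π`
(`IsResolution.mem_excCurvePoints_or_isClosed`: `{x_e}` closed would make `{e} = ρ{x_e}` closed) with
`ρ x_e = e ≠ y`.  Finally `excCurvePoints π ⊆ excPoints π` is finite (`excPoints_finite`).

No definitions, no named facts; nothing about (1.2) itself is proved here.

## Sources

* M. Temkin, Adv. Math. 219 (2008), §2.1 (p. 6): pro-open pro-subschemes `X ×_Y Spec 𝒪_{Y,y}`. [Temkin2008]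
* J. Lipman, Publ. Math. IHÉS 36 (1969), §10 (p. 212) and proof of Prop. (1.2), p. 200. [Lipman1969]
* The Stacks Project, Tag 02IZ (`dim 𝒪_{X,x}` = codimension of `x`). [StacksProject]
-/

noncomputable section

open CategoryTheory CategoryTheory.Limits AlgebraicGeometry TopologicalSpace Topology IsLocalRing
open Scheme.IdealSheafData

universe u

namespace Literature.AlgebraicGeometry.Resolution

/-! ## Birational morphisms and resolutions under the flat base change `Spec 𝒪_{X,x} → X` -/

/-- **Birational morphisms are stable under flat base change (Noetherian case).** Given a cartesian square
`q ≫ π = π' ≫ p` with `p` flat and `X`, `Y` Noetherian spaces, if `π : Y ⟶ X` is birational then so is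
`π' : Y' ⟶ X'`: over `p⁻¹U` (`U` an open over which `π` is an isomorphism) `π'` is a base change of `π ∣_ U`,
and `p⁻¹U`, `π'⁻¹p⁻¹U = q⁻¹π⁻¹U` are dense as preimages of dense opens under flat morphisms to Noetherian
spaces (`dense_preimage_of_flat`).  (Literature copy of the Descent route's Summits-side lemma; the flat
affine-base case is `IsBirational.pullback_snd_of_flat`.) [cite: StacksProject, Tag 01RN] -/
theorem IsBirational.of_isPullback_of_flat {Y' Y X' X : Scheme.{u}} {q : Y' ⟶ Y} {π' : Y' ⟶ X'}
    {π : Y ⟶ X} {p : X' ⟶ X} (sq : IsPullback q π' π p) [Flat p] [NoetherianSpace X]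
    [NoetherianSpace Y] (h : IsBirational π) : IsBirational π' := by
  haveI : Flat q := MorphismProperty.of_isPullback sq.flip ‹Flat p›
  obtain ⟨U, hU, hU', hiso⟩ := h
  refine ⟨p ⁻¹ᵁ U, ?_, ?_, ?_⟩
  · exact dense_preimage_of_flat p U.isOpen hU
  · have hpre : π' ⁻¹ᵁ (p ⁻¹ᵁ U) = q ⁻¹ᵁ (π ⁻¹ᵁ U) := by
      rw [← Scheme.Hom.comp_preimage, ← Scheme.Hom.comp_preimage, sq.w]
    rw [hpre]
    exact dense_preimage_of_flat q (π ⁻¹ᵁ U).isOpen hU'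
  · haveI := hiso
    have t := (isPullback_morphismRestrict π U).flip
    have s := (isPullback_morphismRestrict π' (p ⁻¹ᵁ U)).flip.paste_horiz sq
    rw [← morphismRestrict_ι p U] at s
    exact (IsPullback.of_right' s t).isIso_snd_of_isIso

/-- **The base change `Z ×_X Spec 𝒪_{X,x} → Spec 𝒪_{X,x}` of a resolution `ρ : Z → X` (`X` integral) is a
resolution of `Spec 𝒪_{X,x}`**: proper; birational by flat base change (`flat_fromSpecStalk`); regular source,
the projection to `Z` being a flat preimmersion (`mem_regularLocus_iff_pullback_fst_fromSpecStalk`).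
[cite: Temkin2008, §2.1 (p. 6)] -/
theorem IsResolution.pullback_snd_fromSpecStalk {X Z : Scheme.{u}} [IsIntegral X] [NoetherianSpace X]
    [NoetherianSpace Z] {ρ : Z ⟶ X} (hρ : IsResolution ρ) (x : X) :
    IsResolution (pullback.snd ρ (X.fromSpecStalk x)) := by
  haveI := hρ.isProper
  haveI := flat_fromSpecStalk X x
  have sq := IsPullback.of_hasPullback ρ (X.fromSpecStalk x)
  refine ⟨inferInstance, IsBirational.of_isPullback_of_flat sq hρ.isBirational, fun s => ?_⟩
  exact (Scheme.mem_regularLocus s).mp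
    ((mem_regularLocus_iff_pullback_fst_fromSpecStalk ρ x s).mpr
      ((Scheme.mem_regularLocus _).mpr (hρ.isRegular _)))

/-! ## Points of a proper scheme over a local ring -/

/-- Over a local base, every point of a proper `g : Y → Spec T` specialises to a closed point of `Y` lying
over the closed point (`Y` is quasi-compact; proper maps are closed, and the closed point of `Spec T` is its
only closed point). [folklore] -/
private theorem exists_specializes_isClosed_base_eq_closedPoint {T : Type u} [CommRing T] [IsLocalRing T]
    {Y : Scheme.{u}} (g : Y ⟶ Spec (.of T)) [IsProper g] (y : Y) :
    ∃ c : Y, y ⤳ c ∧ IsClosed ({c} : Set Y) ∧ g.base c = closedPoint T := by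
  haveI : CompactSpace Y := QuasiCompact.compactSpace_of_compactSpace g
  obtain ⟨c, hc, hccl⟩ := (isClosed_closure (s := ({y} : Set Y))).exists_closed_singleton
    ⟨y, subset_closure rfl⟩
  refine ⟨c, specializes_iff_mem_closure.mpr hc, hccl, ?_⟩
  have himg : IsClosed ({g.base c} : Set (Spec (.of T))) := by
    have := g.isClosedMap _ hccl
    rwa [Set.image_singleton] at this
  have hmax := (PrimeSpectrum.isClosed_singleton_iff_isMaximal (g.base c)).mp himg
  exact PrimeSpectrum.ext (IsLocalRing.eq_maximalIdeal hmax)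

/-- In the specialisation preorder of a scheme (`x ≤ y ↔ y ⤳ x`), a proper specialisation is strictly
smaller (schemes are `T₀`). [folklore] -/
private theorem lt_of_specializes_of_ne'' {X : Scheme.{u}} {x y : X} (h : y ⤳ x) (hne : x ≠ y) :
    x < y :=
  ⟨Scheme.le_iff_specializes.2 h, fun h' => hne ((Scheme.le_iff_specializes.1 h').antisymm h).eq⟩

/-- **A point with a two-dimensional local ring on a proper `T`-scheme all of whose local rings have
dimension `≤ 2` (`T` local) is a closed point lying over the closed point**: it specialises to a closed point
`c` over `𝔪`, and a proper specialisation would give `dim 𝒪_{Y,c} ≥ 3` (`dim 𝒪_{Y,y} = codim y`, Stacks 02IZ).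
[cite: StacksProject, Tag 02IZ] -/
theorem isClosed_singleton_of_ringKrullDim_stalk_eq_two {T : Type u} [CommRing T] [IsLocalRing T]
    {Y : Scheme.{u}} (g : Y ⟶ Spec (.of T)) [IsProper g]
    (hdim : ∀ y : Y, ringKrullDim (Y.presheaf.stalk y) ≤ 2) {y : Y}
    (hy : ringKrullDim (Y.presheaf.stalk y) = 2) :
    IsClosed ({y} : Set Y) ∧ g.base y = closedPoint T := by
  obtain ⟨c, hyc, hccl, hc⟩ := exists_specializes_isClosed_base_eq_closedPoint g y
  suffices h : c = y by subst h; exact ⟨hccl, hc⟩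
  by_contra hne
  have hlt : c < y := lt_of_specializes_of_ne'' hyc hne
  have h1 := Order.coheight_add_one_le hlt
  have ey := AlgebraicGeometry.ringKrullDim_stalk_eq_coheight y
  have ec := AlgebraicGeometry.ringKrullDim_stalk_eq_coheight c
  rw [hy] at ey
  have hy2 : Order.coheight y = 2 := by
    rw [show (2 : WithBot ℕ∞) = ((2 : ℕ∞) : WithBot ℕ∞) from rfl] at ey
    exact (WithBot.coe_eq_coe.mp ey).symm
  have hc2 : Order.coheight c ≤ 2 := by
    have h := hdim c
    rw [ec, show (2 : WithBot ℕ∞) = ((2 : ℕ∞) : WithBot ℕ∞) from rfl] at h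
    exact WithBot.coe_le_coe.mp h
  rw [hy2] at h1
  exact absurd (h1.trans hc2) (by decide)

/-! ## The local ring and the ideal of the closed point of `Spec T` -/

/-- The local ring of `Spec T` at the closed point is `T` (the localisation at the units); in particular it
is a regular local ring of the same dimension when `T` is. [folklore] -/
private theorem isRegularLocalRing_stalk_closedPoint (T : Type u) [CommRing T] [IsRegularLocalRing T] :
    IsRegularLocalRing ((Spec (.of T)).presheaf.stalk (closedPoint T)) ∧
      ringKrullDim ((Spec (.of T)).presheaf.stalk (closedPoint T)) = ringKrullDim T := by
  letI : Algebra T ((Spec (.of T)).presheaf.stalk (closedPoint T)) :=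
    StructureSheaf.stalkAlgebra T (closedPoint T)
  haveI : IsLocalization.AtPrime ((Spec (.of T)).presheaf.stalk (closedPoint T)) (maximalIdeal T) :=
    StructureSheaf.IsLocalization.to_stalk T (closedPoint T)
  have e : T ≃+* (Spec (.of T)).presheaf.stalk (closedPoint T) :=
    (IsLocalization.atUnits T (maximalIdeal T).primeCompl (fun s hs => by
      by_contra h
      exact hs ((IsLocalRing.mem_maximalIdeal _).mpr (mem_nonunits_iff.mpr h)))).toRingEquiv
  exact ⟨IsRegularLocalRing.of_ringEquiv e, (ringKrullDim_eq_of_ringEquiv e).symm⟩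

section ClosedPoint

variable (T : Type u) [CommRing T] [IsLocalRing T]

/-- On `Spec T`, `T` local: the stalk at the closed point of an ideal sheaf with top ideal `𝔪_T` is the
maximal ideal of the local ring `𝒪_{Spec T, 𝔪}`. [folklore] -/
private theorem stalkIdeal_closedPoint_eq_maximalIdeal (I : (Spec (.of T)).IdealSheafData)
    (hI : I.ideal ⟨⊤, isAffineOpen_top _⟩ =
      Ideal.map (Scheme.ΓSpecIso (.of T)).inv.hom (maximalIdeal T)) :
    stalkIdeal I (closedPoint T) = maximalIdeal ((Spec (.of T)).presheaf.stalk (closedPoint T)) := by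
  letI : Algebra T ((Spec (.of T)).presheaf.stalk (closedPoint T)) :=
    StructureSheaf.stalkAlgebra T (closedPoint T)
  haveI : IsLocalization.AtPrime ((Spec (.of T)).presheaf.stalk (closedPoint T))
      (closedPoint T).asIdeal :=
    StructureSheaf.IsLocalization.to_stalk T (closedPoint T)
  have hgerm : ((Spec (.of T)).presheaf.germ ⊤ (closedPoint T) trivial).hom.comp
      (Scheme.ΓSpecIso (.of T)).inv.hom = algebraMap T ((Spec (.of T)).presheaf.stalk (closedPoint T)) := by
    rw [← CommRingCat.hom_comp, Scheme.ΓSpecIso_inv]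
    exact congrArg CommRingCat.Hom.hom
      (StructureSheaf.algebraMap_germ (R := T) ⊤ (closedPoint T) trivial)
  rw [stalkIdeal_eq_map_germ I ⟨⊤, isAffineOpen_top _⟩
      (trivial : closedPoint T ∈ (⊤ : (Spec (.of T)).Opens)), hI, Ideal.map_map, hgerm]
  exact IsLocalization.AtPrime.map_eq_maximalIdeal (closedPoint T).asIdeal _

end ClosedPoint

/-! ## The measure drops -/

/-- **A resolution of a two-dimensional Noetherian local domain has finitely many integral exceptional
curves**: `excCurvePoints π ⊆ excPoints π` (`IsResolution.excCurvePoints_subset_excPoints`), and the closed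
fibre of the proper `π` has finitely many maximal points (`excPoints_finite`). [cite: Lipman1969, Section 10 (p. 212)] -/
theorem IsResolution.excCurvePoints_finite {T : Type u} [CommRing T] [IsNoetherianRing T] [IsDomain T]
    [IsLocalRing T] (h2 : ringKrullDim T = 2) {X : Scheme.{u}} {π : X ⟶ Spec (.of T)}
    (hπ : IsResolution π) : (excCurvePoints π).Finite := by
  haveI : IsProper π := hπ.isProper
  exact (excPoints_finite π).subset (hπ.excCurvePoints_subset_excPoints h2)

section MeasureDrop

variable {T : Type u} [CommRing T] [IsRegularLocalRing T]

/-- **The exceptional fibre of the blow-up of the closed point of a regular local ring of dimension `≥ 2`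
has a non-closed point** lying over the closed point (the generic point of `E₁ ≅ ℙ^{d-1}_κ`,
`IsBlowup.exists_specializes_ne_of_mem_preimage`). [cite: Liu2002, Thm. 8.1.19 (b)] -/
theorem exists_not_isClosed_of_isBlowup_closedPoint (h2 : 2 ≤ ringKrullDim T)
    (I : (Spec (.of T)).IdealSheafData)
    (hI : I.ideal ⟨⊤, isAffineOpen_top _⟩ =
      Ideal.map (Scheme.ΓSpecIso (.of T)).inv.hom (maximalIdeal T))
    {Y₁ : Scheme.{u}} {bl : Y₁ ⟶ Spec (.of T)} (hbl : IsBlowup bl I) :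
    ∃ e : Y₁, bl.base e = closedPoint T ∧ ¬ IsClosed ({e} : Set Y₁) := by
  obtain ⟨hreg, hdim⟩ := isRegularLocalRing_stalk_closedPoint T
  haveI := hreg
  have hclosed : IsClosed ({closedPoint T} : Set (Spec (.of T))) :=
    (PrimeSpectrum.isClosed_singleton_iff_isMaximal (closedPoint T)).mpr
      (IsLocalRing.maximalIdeal.isMaximal T)
  obtain ⟨e, x', hfib, hx', hex', hx'e⟩ := hbl.exists_specializes_ne_of_mem_preimage (closedPoint T)
    (stalkIdeal_closedPoint_eq_maximalIdeal T I hI) (hdim ▸ h2) hclosed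
  refine ⟨e, ?_, fun hcl => hx'e ?_⟩
  · have he : e ∈ bl ⁻¹' {closedPoint T} := hfib ▸ subset_closure (Set.mem_singleton e)
    exact he
  · rw [hfib, hcl.closure_eq] at hx'
    simpa using hx'

/-- **(M) the measure drops**: with `π = ρ ≫ bl` (`bl` the blow-up of the closed point of the two-dimensional
regular local ring `T`, `ρ` proper birational) and `y` a point of `Y₁` with `dim 𝒪_{Y₁,y} = 2` (a closed point
of the exceptional curve), the base change `ρ_y : X ×_{Y₁} Spec 𝒪_{Y₁,y} → Spec 𝒪_{Y₁,y}` (bound as `ρy` with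
its codomain spelled `Spec (.of _)`) is a resolution and has strictly fewer integral exceptional curves than
`π`: `pullback.fst` is injective and stalk-preserving (base change of the preimmersion `fromSpecStalk`) and
maps them into those exceptional curves of `π` that `ρ` sends to `y`, missing the one over the generic point
of the exceptional curve of `bl`.  (The skeleton's stub carries an extra hypothesis
`(excCurvePoints π).Nonempty`, which is not needed: the exceptional curve over the generic point of `E₁` exists
unconditionally; the stub is this theorem applied to its remaining binders.) [cite: Temkin2008, §2.1 (p. 6)]
[cite: Lipman1969, Section 10 (p. 212)] -/
theorem isResolution_pullback_fromSpecStalk_and_ncard_excCurvePoints_lt (hT : ringKrullDim T = 2)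
    {X : Scheme.{u}} (π : X ⟶ Spec (.of T)) (hπ : IsResolution π)
    (I : (Spec (.of T)).IdealSheafData)
    (hI : I.ideal ⟨⊤, isAffineOpen_top _⟩ =
      Ideal.map (Scheme.ΓSpecIso (.of T)).inv.hom (maximalIdeal T))
    {Y₁ : Scheme.{u}} (bl : Y₁ ⟶ Spec (.of T)) (hbl : IsBlowup bl I)
    (ρ : X ⟶ Y₁) (hfac : ρ ≫ bl = π) [IsProper ρ] (hρ : IsBirational ρ)
    (y : Y₁) (hy : ringKrullDim (Y₁.presheaf.stalk y) = 2)
    (ρy : pullback ρ (Y₁.fromSpecStalk y) ⟶ Spec (.of (Y₁.presheaf.stalk y)))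
    (hρy : ρy = pullback.snd ρ (Y₁.fromSpecStalk y)) :
    IsResolution ρy ∧ (excCurvePoints ρy).ncard < (excCurvePoints π).ncard := by
  haveI := isDomain_of_isRegularLocalRing T
  haveI : IsProper π := hπ.isProper
  haveI : IsNoetherian X := by
    haveI : IsLocallyNoetherian X := LocallyOfFiniteType.isLocallyNoetherian π
    haveI : CompactSpace X := QuasiCompact.compactSpace_of_compactSpace π
    exact {}
  obtain ⟨hY1int, hY1noeth, hblprop, -, hdimY⟩ :=
    isRegular_of_isBlowup_closedPoint_of_isRegularLocalRing hT I hI bl hbl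
  haveI := hY1int
  haveI := hY1noeth
  haveI := hblprop
  -- (1) `ρ_y` is a resolution (flat base change of the resolution `ρ`)
  have hres : IsResolution ρy :=
    hρy ▸ (⟨‹IsProper ρ›, hρ, hπ.isRegular⟩ : IsResolution ρ).pullback_snd_fromSpecStalk y
  refine ⟨hres, ?_⟩
  -- notation: the projection `f : X ×_{Y₁} Spec 𝒪_{Y₁,y} → X`
  set f := pullback.fst ρ (Y₁.fromSpecStalk y) with hf
  -- (2) the exceptional curves of `π` are finitely many
  have hfin : (excCurvePoints π).Finite := hπ.excCurvePoints_finite hT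
  -- (3) `y` is a closed point over `𝔪`
  obtain ⟨hyc, hy𝔪⟩ := isClosed_singleton_of_ringKrullDim_stalk_eq_two bl hdimY hy
  -- (4) `f` is injective and maps `excCurvePoints ρ_y` into `{η ∈ excCurvePoints π | ρ η = y}`
  have hfinj : Function.Injective f.base := f.isEmbedding.injective
  have hρf : ∀ s, ρy.base s = closedPoint _ → ρ.base (f.base s) = y := by
    intro s hs
    rw [hf, ← Scheme.Hom.comp_apply, pullback.condition, Scheme.Hom.comp_apply, ← hρy, hs,
      Scheme.fromSpecStalk_closedPoint]
  have hπf : ∀ s, ρy.base s = closedPoint _ → π.base (f.base s) = closedPoint T := by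
    intro s hs
    rw [← hfac, Scheme.Hom.comp_apply, hρf s hs, hy𝔪]
  have hmap : ∀ s ∈ excCurvePoints ρy, f.base s ∈ excCurvePoints π := by
    rintro s ⟨hs, hhs⟩
    refine ⟨hπf s hs, le_antisymm (hπ.height_le_one_of_base_eq_closedPoint hT (hπf s hs)) ?_⟩
    -- a proper specialisation of `s` maps to a proper specialisation of `f s`
    have hs0 : ¬ IsMin s := fun hmin => by
      rw [← Order.height_eq_zero] at hmin
      rw [hmin] at hhs
      exact zero_ne_one hhs
    obtain ⟨s', hs's⟩ := not_isMin_iff.mp hs0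
    have hsp : s ⤳ s' := Scheme.le_iff_specializes.1 hs's.le
    have hlt : f.base s' < f.base s :=
      lt_of_specializes_of_ne'' (hsp.map f.continuous) (fun h => hs's.ne (hfinj h))
    exact le_add_self.trans (Order.height_add_one_le hlt)
  -- (5) an exceptional curve of `π` NOT contracted to `y`: one over the generic point of `E₁`
  obtain ⟨xe, hxe, hxey⟩ : ∃ xe ∈ excCurvePoints π, ρ.base xe ≠ y := by
    obtain ⟨e, he𝔪, hecl⟩ := exists_not_isClosed_of_isBlowup_closedPoint (hT ▸ le_rfl) I hI hbl
    haveI : IsDominant ρ := hρ.isDominant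
    obtain ⟨xe, hxe⟩ := ρ.surjective e
    have hπxe : π.base xe = closedPoint T := by
      rw [← hfac, Scheme.Hom.comp_apply, hxe, he𝔪]
    refine ⟨xe, (hπ.mem_excCurvePoints_or_isClosed hT hπxe).resolve_right fun hcl => hecl ?_, ?_⟩
    · have := ρ.isClosedMap _ hcl
      rwa [Set.image_singleton, hxe] at this
    · rw [hxe]
      rintro rfl
      exact hecl hyc
  -- (6) counting
  have hsub : f.base '' excCurvePoints ρy ⊆ excCurvePoints π := by
    rintro _ ⟨s, hs, rfl⟩
    exact hmap s hs
  have hssub : f.base '' excCurvePoints ρy ⊂ excCurvePoints π := by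
    refine ⟨hsub, fun h => hxey ?_⟩
    obtain ⟨s, hs, hsx⟩ := h hxe
    rw [← hsx]
    exact hρf s hs.1
  rw [← Set.ncard_image_of_injective (excCurvePoints ρy) hfinj]
  exact Set.ncard_lt_ncard hssub hfin

end MeasureDrop

end Literature.AlgebraicGeometry.Resolution

end
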